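import Mathlib
import Summits.Ventures.PercRepro2.Defs
import Summits.Ventures.PercRepro2.Harris
import Summits.Ventures.PercRepro2.CoinDefs
import Summits.Ventures.PercRepro2.CoinStarDefs
import Summits.Ventures.PercRepro2.CoinLsmCoreDefs
import Summits.Ventures.PercRepro2.CoinLsmCoreU
import Summits.Ventures.PercRepro2.CoinCoreGate
import Summits.Ventures.PercRepro2.CoinOrTailKDefs
import Summits.Ventures.PercRepro2.CoinOrTailKSums
import Summits.Ventures.PercRepro2.CoinOrTailLsmCore
import Summits.Ventures.PercRepro2.CoinTreeCore
import Summits.Ventures.PercRepro2.CoinKSureCore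
import Summits.Ventures.PercRepro2.CoinKSureTailSums
import Summits.Ventures.PercRepro2.CoinKSureGen
import Summits.Ventures.PercRepro2.CoinKSureCloseStar
import Summits.Ventures.PercRepro2.CoinKSureTwoLevel
import Summits.Ventures.PercRepro2.CoinKSureMarkerB

/-!
# Row 2′DARC at an OR-tail with BOTH markers at OR-vertices: the free arc's tail `a` and a
second sure OR-vertex `b` of the head (blind cell PercRepro2, night-2 g15;
proofs/NIGHT2-DARC.md §55)

The two level reductions of §53 with the marker at `a` as well: at the outer (`b`) level the
indicator of `a` is a marker constant in `b`, at the inner (`a`) level it vanishes off `a`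
(`sum_gen_tail`) and with sure `a`-coins becomes the entry indicator `entInd ent`
(`rValKa_sure`).  `darc_of_orTailKSure_markerAB`: markers `(a, b)`, sure coins on both.
-/

namespace Summit.Ventures.PercRepro2.Coin

open Classical

section TwoLevelA

variable {V : Type*} {E : Type*} [DecidableEq V] [Fintype E] [DecidableEq E]
  {R : Type*} [Field R]
  {arcs : E → Finset (V × V)} {s : V} {U : Finset V} {ent : Finset V} {c : V → E} {a w : V}
  {entb : Finset V} {d : V → E} {b : V}

/-- The entry indicator of `a`'s entries is constant in `b` (`b ∉ ent`). -/
lemma entInd_insert_of_notMem (ent : Finset V) {x : V} (hx : x ∉ ent) (W : Finset V) :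
    (entInd ent (insert x W) : R) = entInd ent W := by
  unfold entInd
  apply if_congr _ rfl rfl
  constructor
  · rintro ⟨r, hr, hrW⟩
    rw [Finset.mem_insert] at hrW
    rcases hrW with rfl | hrW
    · exact absurd hr hx
    · exact ⟨r, hr, hrW⟩
  · rintro ⟨r, hr, hrW⟩
    exact ⟨r, hr, Finset.mem_insert_of_mem hrW⟩

/-- **Two level reductions, `R`-side, the marker at `a`** (times a marker `m` constant in `a`
and `b`), sure `a`-coins. -/
lemma two_level_R_atail (h : OrTailK arcs s U ent c a)
    (hb : OrTailK arcs s (insert a U) entb d b) (hba : b ≠ a)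
    (pr : E → R) (hsure : ∀ r ∈ ent, pr (c r) = 1) (hsureb : ∀ r ∈ entb, pr (d r) = 1)
    (A m : Finset V → R) (hmb : ∀ W, m (insert b W) = m W) (hma : ∀ W, m (insert a W) = m W) :
    ∑ W ∈ (insert b (insert a U)).powerset,
        prob pr (coreLevel arcs s (insert b (insert a U)) W) * A W *
          ((if a ∈ W then (1 : R) else 0) * m W) =
      ∑ W ∈ U.powerset, prob pr (coreLevel arcs s U W) *
        rValK (closeB entb b A) pr ent c a W * (entInd ent W * m W) := by
  have hmb' : ∀ W, (fun W : Finset V => (if a ∈ W then (1 : R) else 0) * m W) (insert b W) =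
      (fun W : Finset V => (if a ∈ W then (1 : R) else 0) * m W) W := by
    intro W
    simp only [Finset.mem_insert, Ne.symm hba, false_or, hmb W]
  rw [hb.sum_gen pr A _ hmb']
  have step : ∀ W ∈ (insert a U).powerset, prob pr (coreLevel arcs s (insert a U) W) *
      (tailWtK pr entb d W * A W + (1 - tailWtK pr entb d W) * A (W ∪ {b})) *
        ((if a ∈ W then (1 : R) else 0) * m W) =
      prob pr (coreLevel arcs s (insert a U) W) * closeB entb b A W *
        ((if a ∈ W then (1 : R) else 0) * m W) := by
    intro W _
    rw [closeB_of_sure pr d b A hsureb W]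
  have hg0 : ∀ W, a ∉ W → (fun W : Finset V => (if a ∈ W then (1 : R) else 0) * m W) W = 0 := by
    intro W haW; simp only [haW, if_false, zero_mul]
  have hg1 : ∀ W, a ∉ W → (fun W : Finset V => (if a ∈ W then (1 : R) else 0) * m W) (insert a W) = m W := by
    intro W _; simp only [Finset.mem_insert_self, if_true, one_mul, hma W]
  rw [Finset.sum_congr rfl step, h.sum_gen_tail pr (closeB entb b A) _ m hg0 hg1]
  refine Finset.sum_congr rfl fun W _ => ?_
  have := rValKa_sure (closeB entb b A) pr c a hsure W
  unfold rValKa at this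
  rw [this]
  unfold entInd
  ring

/-- **Two level reductions, gate side, the marker at `a`**, sure `a`-coins. -/
lemma two_level_G_atail (h : OrTailK arcs s U ent c a)
    (hb : OrTailK arcs s (insert a U) entb d b) (hae : a ∉ entb) (hwe : w ∉ entb) (hba : b ≠ a)
    (pr : E → R) (hsure : ∀ r ∈ ent, pr (c r) = 1) (hsureb : ∀ r ∈ entb, pr (d r) = 1)
    (A m : Finset V → R) (hmb : ∀ W, m (insert b W) = m W) (hma : ∀ W, m (insert a W) = m W) :
    ∑ W ∈ (insert b (insert a U)).powerset,
        prob pr (coreLevel arcs s (insert b (insert a U)) W) * A (starTarget a w W) *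
          ((if a ∈ W then (1 : R) else 0) * m W) =
      ∑ W ∈ U.powerset, prob pr (coreLevel arcs s U W) *
        gValK (closeB entb b A) pr ent c a w W * (entInd ent W * m W) := by
  have hmb' : ∀ W, (fun W : Finset V => (if a ∈ W then (1 : R) else 0) * m W) (insert b W) =
      (fun W : Finset V => (if a ∈ W then (1 : R) else 0) * m W) W := by
    intro W
    simp only [Finset.mem_insert, Ne.symm hba, false_or, hmb W]
  rw [hb.sum_gen pr (fun X => A (starTarget a w X)) _ hmb']
  have step : ∀ W ∈ (insert a U).powerset, prob pr (coreLevel arcs s (insert a U) W) *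
      (tailWtK pr entb d W * A (starTarget a w W) +
        (1 - tailWtK pr entb d W) * A (starTarget a w (W ∪ {b}))) *
        ((if a ∈ W then (1 : R) else 0) * m W) =
      prob pr (coreLevel arcs s (insert a U) W) *
        closeB entb b (fun X => A (starTarget a w X)) W * ((if a ∈ W then (1 : R) else 0) * m W) := by
    intro W _
    have := closeB_of_sure pr d b (fun X => A (starTarget a w X)) hsureb W
    beta_reduce at this
    rw [this]
  have hg0 : ∀ W, a ∉ W → (fun W : Finset V => (if a ∈ W then (1 : R) else 0) * m W) W = 0 := by
    intro W haW; simp only [haW, if_false, zero_mul]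
  have hg1 : ∀ W, a ∉ W → (fun W : Finset V => (if a ∈ W then (1 : R) else 0) * m W) (insert a W) = m W := by
    intro W _; simp only [Finset.mem_insert_self, if_true, one_mul, hma W]
  rw [Finset.sum_congr rfl step,
    h.sum_gen_tail pr (closeB entb b (fun X => A (starTarget a w X))) _ m hg0 hg1]
  refine Finset.sum_congr rfl fun W hW => ?_
  have hWU : W ⊆ U := Finset.mem_powerset.1 hW
  have haW : a ∉ W := fun haW => h.a_notin (hWU haW)
  rw [closeB_star_insert entb A hae hwe]
  unfold gValK
  rw [tailWtK_sure pr c hsure W]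
  unfold entInd
  split_ifs <;> ring

end TwoLevelA

section TwoLevelAB

variable {V : Type*} {E : Type*} [DecidableEq V] [Fintype E] [DecidableEq E]
  {R : Type*} [Field R]
  {arcs : E → Finset (V × V)} {s : V} {U : Finset V} {ent : Finset V} {c : V → E} {a w : V}
  {entb : Finset V} {d : V → E} {b : V}

/-- **Two level reductions, `R`-side, the markers at `a` AND `b`**, sure coins. -/
lemma two_level_R_abtail (h : OrTailK arcs s U ent c a)
    (hb : OrTailK arcs s (insert a U) entb d b) (hae : a ∉ entb) (hba : b ≠ a)
    (pr : E → R) (hsure : ∀ r ∈ ent, pr (c r) = 1) (hsureb : ∀ r ∈ entb, pr (d r) = 1)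
    (A : Finset V → R) :
    ∑ W ∈ (insert b (insert a U)).powerset,
        prob pr (coreLevel arcs s (insert b (insert a U)) W) * A W *
          ((if a ∈ W then (1 : R) else 0) * (if b ∈ W then (1 : R) else 0)) =
      ∑ W ∈ U.powerset, prob pr (coreLevel arcs s U W) *
        rValK (closeB entb b A) pr ent c a W * (entInd ent W * entInd entb W) := by
  have hg0 : ∀ W, b ∉ W →
      (fun W : Finset V => (if a ∈ W then (1 : R) else 0) * (if b ∈ W then (1 : R) else 0)) W = 0 := by
    intro W hbW; simp only [hbW, if_false, mul_zero]
  have hg1 : ∀ W, b ∉ W →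
      (fun W : Finset V => (if a ∈ W then (1 : R) else 0) * (if b ∈ W then (1 : R) else 0)) (insert b W) =
        (fun W : Finset V => if a ∈ W then (1 : R) else 0) W := by
    intro W _
    simp only [Finset.mem_insert_self, if_true, mul_one, Finset.mem_insert, Ne.symm hba, false_or]
  rw [hb.sum_gen_tail pr A _ _ hg0 hg1]
  have step : ∀ W ∈ (insert a U).powerset, prob pr (coreLevel arcs s (insert a U) W) *
      ((1 - tailWtK pr entb d W) * A (W ∪ {b})) * (if a ∈ W then (1 : R) else 0) =
      prob pr (coreLevel arcs s (insert a U) W) * closeB entb b A W *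
        (entInd entb W * (if a ∈ W then (1 : R) else 0)) := by
    intro W _
    rw [closeB_of_sure_tail pr d b A hsureb W]
    unfold entInd
    ring
  have hg0' : ∀ W, a ∉ W → (fun W : Finset V => entInd entb W * (if a ∈ W then (1 : R) else 0)) W = 0 := by
    intro W haW; simp only [haW, if_false, mul_zero]
  have hg1' : ∀ W, a ∉ W →
      (fun W : Finset V => entInd entb W * (if a ∈ W then (1 : R) else 0)) (insert a W) = entInd entb W := by
    intro W _
    simp only [Finset.mem_insert_self, if_true, mul_one]
    exact entInd_insert_of_notMem entb hae W
  rw [Finset.sum_congr rfl step, h.sum_gen_tail pr (closeB entb b A) _ _ hg0' hg1']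
  refine Finset.sum_congr rfl fun W _ => ?_
  have := rValKa_sure (closeB entb b A) pr c a hsure W
  unfold rValKa at this
  rw [this]
  unfold entInd
  ring

/-- **Two level reductions, gate side, the markers at `a` AND `b`**, sure coins. -/
lemma two_level_G_abtail (h : OrTailK arcs s U ent c a)
    (hb : OrTailK arcs s (insert a U) entb d b) (hae : a ∉ entb) (hwe : w ∉ entb) (hba : b ≠ a)
    (pr : E → R) (hsure : ∀ r ∈ ent, pr (c r) = 1) (hsureb : ∀ r ∈ entb, pr (d r) = 1)
    (A : Finset V → R) :
    ∑ W ∈ (insert b (insert a U)).powerset,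
        prob pr (coreLevel arcs s (insert b (insert a U)) W) * A (starTarget a w W) *
          ((if a ∈ W then (1 : R) else 0) * (if b ∈ W then (1 : R) else 0)) =
      ∑ W ∈ U.powerset, prob pr (coreLevel arcs s U W) *
        gValK (closeB entb b A) pr ent c a w W * (entInd ent W * entInd entb W) := by
  have hg0 : ∀ W, b ∉ W →
      (fun W : Finset V => (if a ∈ W then (1 : R) else 0) * (if b ∈ W then (1 : R) else 0)) W = 0 := by
    intro W hbW; simp only [hbW, if_false, mul_zero]
  have hg1 : ∀ W, b ∉ W →
      (fun W : Finset V => (if a ∈ W then (1 : R) else 0) * (if b ∈ W then (1 : R) else 0)) (insert b W) =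
        (fun W : Finset V => if a ∈ W then (1 : R) else 0) W := by
    intro W _
    simp only [Finset.mem_insert_self, if_true, mul_one, Finset.mem_insert, Ne.symm hba, false_or]
  rw [hb.sum_gen_tail pr (fun X => A (starTarget a w X)) _ _ hg0 hg1]
  have step : ∀ W ∈ (insert a U).powerset, prob pr (coreLevel arcs s (insert a U) W) *
      ((1 - tailWtK pr entb d W) * A (starTarget a w (W ∪ {b}))) * (if a ∈ W then (1 : R) else 0) =
      prob pr (coreLevel arcs s (insert a U) W) * closeB entb b (fun X => A (starTarget a w X)) W *
        (entInd entb W * (if a ∈ W then (1 : R) else 0)) := by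
    intro W _
    have := closeB_of_sure_tail pr d b (fun X => A (starTarget a w X)) hsureb W
    beta_reduce at this
    rw [this]
    unfold entInd
    ring
  have hg0' : ∀ W, a ∉ W → (fun W : Finset V => entInd entb W * (if a ∈ W then (1 : R) else 0)) W = 0 := by
    intro W haW; simp only [haW, if_false, mul_zero]
  have hg1' : ∀ W, a ∉ W →
      (fun W : Finset V => entInd entb W * (if a ∈ W then (1 : R) else 0)) (insert a W) = entInd entb W := by
    intro W _
    simp only [Finset.mem_insert_self, if_true, mul_one]
    exact entInd_insert_of_notMem entb hae W
  rw [Finset.sum_congr rfl step,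
    h.sum_gen_tail pr (closeB entb b (fun X => A (starTarget a w X))) _ _ hg0' hg1']
  refine Finset.sum_congr rfl fun W _ => ?_
  rw [closeB_star_insert entb A hae hwe]
  unfold gValK
  rw [tailWtK_sure pr c hsure W]
  unfold entInd
  split_ifs <;> ring

end TwoLevelAB

section MarkerAB

variable {V : Type*} {E : Type*} [Fintype V] [DecidableEq V] [Fintype E] [DecidableEq E]
  {R : Type*} [Field R] [LinearOrder R] [IsStrictOrderedRing R]
  {arcs : E → Finset (V × V)} {s : V} {U : Finset V} {ent : Finset V} {c : V → E} {a w : V}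
  {entb : Finset V} {d : V → E} {b : V}

/-- **THEOREM (row 2′DARC at an OR-tail, BOTH markers at OR-vertices: the tail `a` of the free
arc and a second sure OR-vertex `b` of the head).** Sure coins on both. -/
theorem darc_of_orTailKSure_markerAB (pr : E → R) (hp : IsProbVec pr) (hS : SameEnds arcs)
    (h : OrTailK arcs s U ent c a) (hb : OrTailK arcs s (insert a U) entb d b) (hae : a ∉ entb)
    (hsure : ∀ r ∈ ent, pr (c r) = 1) (hsureb : ∀ r ∈ entb, pr (d r) = 1)
    (hν : ∀ W W', W ⊆ U → W' ⊆ U →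
      prob pr (coreLevel arcs s U W) * prob pr (coreLevel arcs s U W') ≤
        prob pr (coreLevel arcs s U (W ∩ W')) * prob pr (coreLevel arcs s U (W ∪ W')))
    {t : V} (htC : t ∉ insert b (insert a U)) (hts : t ≠ s) (hws : w ≠ s)
    (hwC : w ∉ insert b (insert a U)) :
    DARC pr arcs s {t} a b a w := by
  have hC := hb.closedInCoreU
  have hba : b ≠ a := fun e => hb.a_notin (e ▸ Finset.mem_insert_self a U)
  have hbU : b ∉ U := fun hbU => hb.a_notin (Finset.mem_insert_of_mem hbU)
  have hbC : b ∈ insert b (insert a U) := Finset.mem_insert_self _ _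
  have haC : a ∈ insert b (insert a U) := Finset.mem_insert_of_mem (Finset.mem_insert_self _ _)
  have hwe : w ∉ entb := fun hw => hwC (Finset.mem_insert_of_mem (hb.ent_sub hw))
  have hbw : b ≠ w := fun e => hwC (e ▸ hbC)
  unfold DARC
  rw [hC.phiC_gate_eq pr hS htC hts haC hbC haC hws hwC]
  set A : Finset V → R := fun X => prob pr (coreAvoidEvent arcs s t (insert b (insert a U)) X)
    with hAdef
  have hm1b : ∀ W : Finset V, (fun _ : Finset V => (1 : R)) (insert b W) = (fun _ => (1 : R)) W :=
    fun _ => rfl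
  have hm1a : ∀ W : Finset V, (fun _ : Finset V => (1 : R)) (insert a W) = (fun _ => (1 : R)) W :=
    fun _ => rfl
  have hgb0 : ∀ W : Finset V, b ∉ W → (fun W : Finset V => if b ∈ W then (1 : R) else 0) W = 0 := by
    intro W hbW; simp only [hbW, if_false]
  have hgb1 : ∀ W : Finset V, b ∉ W →
      (fun W : Finset V => if b ∈ W then (1 : R) else 0) (insert b W) = (fun _ => (1 : R)) W := by
    intro W _; simp only [Finset.mem_insert_self, if_true]
  have eΛ := two_level_R h hb pr hsureb A (fun _ => (1 : R)) hm1b hm1a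
  have eΛa := two_level_R_atail h hb hba pr hsure hsureb A (fun _ => (1 : R)) hm1b hm1a
  have eΛb := two_level_R_tail h hb hae pr hsureb A (fun W => if b ∈ W then (1 : R) else 0)
    (fun _ => (1 : R)) hgb0 hgb1 hm1a
  have eM := two_level_G h hb hae hwe hba pr hsureb A (fun _ => (1 : R)) hm1b hm1a
  have eMa := two_level_G_atail h hb hae hwe hba pr hsure hsureb A (fun _ => (1 : R)) hm1b hm1a
  have eMb := two_level_G_tail h hb hae hwe hba pr hsureb A
    (fun W => if b ∈ W then (1 : R) else 0) (fun _ => (1 : R)) hgb0 hgb1 hm1a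
  have eMab := two_level_G_abtail h hb hae hwe hba pr hsure hsureb A
  simp only [mul_one] at eΛ eΛa eΛb eM eMa eMb
  rw [eΛ, eΛa, eΛb, eM, eMa, eMb, eMab]
  have hbW : ∀ W ∈ U.powerset, b ∉ W := fun W hW hbW => hbU (Finset.mem_powerset.1 hW hbW)
  have c1 : ∑ x ∈ U.powerset, prob pr (coreLevel arcs s U x) * rValK (closeB entb b A) pr ent c a x =
      ∑ x ∈ U.powerset, prob pr (coreLevel arcs s U x) * rValK (closeBE entb b A) pr ent c a x :=
    Finset.sum_congr rfl fun W hW => by rw [rValK_closeBE A pr (hbW W hW) hba]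
  have c2 : ∑ x ∈ U.powerset, prob pr (coreLevel arcs s U x) * rValK (closeB entb b A) pr ent c a x *
      entInd ent x =
      ∑ x ∈ U.powerset, prob pr (coreLevel arcs s U x) * rValK (closeBE entb b A) pr ent c a x *
        entInd ent x :=
    Finset.sum_congr rfl fun W hW => by rw [rValK_closeBE A pr (hbW W hW) hba]
  have c3 : ∑ x ∈ U.powerset, prob pr (coreLevel arcs s U x) * rValK (closeB entb b A) pr ent c a x *
      entInd entb x =
      ∑ x ∈ U.powerset, prob pr (coreLevel arcs s U x) * rValK (closeBE entb b A) pr ent c a x *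
        entInd entb x :=
    Finset.sum_congr rfl fun W hW => by rw [rValK_closeBE A pr (hbW W hW) hba]
  have c4 : ∑ x ∈ U.powerset, prob pr (coreLevel arcs s U x) * gValK (closeB entb b A) pr ent c a w x =
      ∑ x ∈ U.powerset, prob pr (coreLevel arcs s U x) * gValK (closeBE entb b A) pr ent c a w x :=
    Finset.sum_congr rfl fun W hW => by rw [gValK_closeBE A pr (hbW W hW) hba hbw]
  have c5 : ∑ x ∈ U.powerset, prob pr (coreLevel arcs s U x) * gValK (closeB entb b A) pr ent c a w x *
      entInd ent x =
      ∑ x ∈ U.powerset, prob pr (coreLevel arcs s U x) * gValK (closeBE entb b A) pr ent c a w x *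
        entInd ent x :=
    Finset.sum_congr rfl fun W hW => by rw [gValK_closeBE A pr (hbW W hW) hba hbw]
  have c6 : ∑ x ∈ U.powerset, prob pr (coreLevel arcs s U x) * gValK (closeB entb b A) pr ent c a w x *
      entInd entb x =
      ∑ x ∈ U.powerset, prob pr (coreLevel arcs s U x) * gValK (closeBE entb b A) pr ent c a w x *
        entInd entb x :=
    Finset.sum_congr rfl fun W hW => by rw [gValK_closeBE A pr (hbW W hW) hba hbw]
  have c7 : ∑ x ∈ U.powerset, prob pr (coreLevel arcs s U x) * gValK (closeB entb b A) pr ent c a w x *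
      (entInd ent x * entInd entb x) =
      ∑ x ∈ U.powerset, prob pr (coreLevel arcs s U x) * gValK (closeBE entb b A) pr ent c a w x *
        (entInd ent x * entInd entb x) :=
    Finset.sum_congr rfl fun W hW => by rw [gValK_closeBE A pr (hbW W hW) hba hbw]
  rw [c1, c2, c3, c4, c5, c6, c7]
  obtain ⟨hA0, hAmono, hAlsm⟩ := OrTailU.head_props (U := insert a U) (a := b) pr hp hS t
  exact orTailKSure_functional_nonneg_markers U (fun W => prob pr (coreLevel arcs s U W))
    (closeBE entb b A) pr ent c a w (fun W => entInd ent W) (fun W => entInd entb W)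
    hp.nonneg hp.le_one hsure (fun W => prob_nonneg hp _)
    (fun s' hs' t' ht' => hν s' t' hs' ht') (closeBE_nonneg entb b A hA0)
    (closeBE_lsm entb b A hA0 hAlsm hAmono) (closeBE_mono entb b A hAmono)
    (fun W => entInd_nonneg ent W) (fun W => entInd_nonneg entb W)
    (fun s t => entInd_mono ent s t) (fun s t => entInd_mono entb s t)

end MarkerAB

end Summit.Ventures.PercRepro2.Coin
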